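import Summits.KontsevichZagierPeriods.KontsevichZagierPeriods.Theses.SymplecticScissors
import Literature.NumberTheory.Transcendental.KZCalculus

/-!
# Crux `PlanarAreas` (stmt-KontsevichZagierPeriods-4990) — ideator 3 sketch (crux-ideate round 1)

Two first lemmas, typed over existing declarations:

* Card `green-native-bands`: `GreenInRelations` (the typed Green generator of crux 10042
  `RealOnePeriodRelations` lies in the FULL relation subgroup `KZ.relations`: Newton–Leibniz along `b` with
  the coefficient `A` itself as primitive, the swap change of variables, Newton–Leibniz along `a`) and
  `AreaSlicing` (an integrand-1 planar representation is congruent modulo `KZ.relations` to a `ℤ`-combination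
  of 1-dimensional representations: cylindrical decomposition + Newton–Leibniz with primitive `y`), with the
  glue `planarAreas_of : RealOnePeriodRelations → GreenInRelations → AreaSlicing → PlanarAreas` PROVED.
* Card `degree-shadow-membranes`: `NullHomotopicNashLoopStatement` — the real realisation of `a·ω` along a
  null-homotopic `ℚ`-semialgebraic `C¹` loop on a smooth affine curve lies in `KZ.relations`.
-/

noncomputable section

open scoped BigOperators
open Set MeasureTheory
open Literature.NumberTheory.Transcendental Literature.NumberTheory.Transcendental.CurvePeriods
open Literature.ModelTheory.ExponentialFields (IsSemialgebraic)

namespace Summit.KontsevichZagierPeriods.KontsevichZagierPeriods.Cruxes.PlanarAreas.Ideator3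

open Summit.KontsevichZagierPeriods.KontsevichZagierPeriods.Theses.SymplecticScissors

/-- The GREEN GENERATOR family of crux 10042, verbatim. [cite: KontsevichZagier2001, §1.2] -/
def greenSet : Set KZ.FormalRep :=
  {g : KZ.FormalRep | ∃ (Δ : Set (Fin 2 → ℝ)) (A B S : (Fin 2 → ℝ) → ℝ) (r₀₁ r₁₂ r₀₂ : KZ.IntegralRep 1),
    Δ = {p | 0 ≤ p 0 ∧ 0 ≤ p 1 ∧ p 0 + p 1 ≤ 1} ∧ IsSemialgebraicFunOn ℚ Δ A ∧ IsSemialgebraicFunOn ℚ Δ B ∧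
    ContinuousOn A Δ ∧ ContinuousOn B Δ ∧
    (∀ p : Fin 2 → ℝ, 0 < p 0 → 0 < p 1 → p 0 + p 1 < 1 →
      HasFDerivAt S (A p • ContinuousLinearMap.proj (R := ℝ) (φ := fun _ : Fin 2 => ℝ) 0 +
        B p • ContinuousLinearMap.proj (R := ℝ) (φ := fun _ : Fin 2 => ℝ) 1) p) ∧
    r₀₁.domain = {z | z 0 ∈ Set.Ioo 0 1} ∧ r₁₂.domain = {z | z 0 ∈ Set.Ioo 0 1} ∧
    r₀₂.domain = {z | z 0 ∈ Set.Ioo 0 1} ∧ (∀ z ∈ r₀₁.domain, r₀₁.integrand z = A ![z 0, 0]) ∧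
    (∀ z ∈ r₁₂.domain, r₁₂.integrand z = B ![1 - z 0, z 0] - A ![1 - z 0, z 0]) ∧
    (∀ z ∈ r₀₂.domain, r₀₂.integrand z = B ![0, z 0]) ∧ g = KZ.of r₀₁ + KZ.of r₁₂ - KZ.of r₀₂}

/-- FIRST LEMMA of card `green-native-bands`: the typed Green generator lies in the full relation subgroup
(three moves on the native band: rule 3 along `b` with primitive `A`, the swap `(a,b) ↦ (b,a)` (rule 2),
rule 3 along `a` with primitive `B`; the common bulk integrand is `∂_b A = ∂_a B`, defined off the
`C¹`-singular set of `A, B` and absolutely integrable by uniform finiteness of the fibrewise monotonicity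
pieces of `A` and `B`). [cite: KontsevichZagier2001, §1.2 rule (3)] -/
def GreenInRelations : Prop := greenSet ⊆ (KZ.relations : Set KZ.FormalRep)

/-- SECOND glue lemma of card `green-native-bands`: every integrand-1 planar representation is congruent
modulo `KZ.relations` to a `ℤ`-combination of 1-dimensional representations (cylindrical decomposition of
the domain into cells `{x ∈ I, φ x < y < ψ x}` and null cells, then rule 3 along `y` with primitive `y`).
[cite: KontsevichZagier2001, §1.1] -/
def AreaSlicing : Prop :=
  ∀ r : KZ.IntegralRep 2, (∀ p ∈ r.domain, r.integrand p = 1) →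
    ∃ c ∈ AddSubgroup.closure (Set.range fun s : KZ.IntegralRep 1 => KZ.of s), KZ.of r - c ∈ KZ.relations

/-- The conclusion set of crux 10042 is `closure (1a ∪ 1b ∪ 2 ∪ greenSet)` (definitional check). -/
example : RealOnePeriodRelations ↔
    ∀ c : KZ.FormalRep, c ∈ AddSubgroup.closure (Set.range fun r : KZ.IntegralRep 1 => KZ.of r) →
      KZ.eval c = 0 →
      c ∈ AddSubgroup.closure (KZ.domainAddRel ∪ KZ.integrandAddRel ∪ KZ.changeOfVariablesRel ∪ greenSet) :=
  Iff.rfl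

/-- GLUE (proved): crux 4990 follows from crux 10042 and the two glue lemmas.
[cite: KontsevichZagier2001, §1.2] -/
theorem planarAreas_of (h : RealOnePeriodRelations) (hG : GreenInRelations) (hS : AreaSlicing) :
    PlanarAreas := by
  intro r r' hr hr' hv
  obtain ⟨c, hc, hrc⟩ := hS r hr
  obtain ⟨c', hc', hrc'⟩ := hS r' hr'
  -- the generators of M₁ are relations
  have hM₁ : AddSubgroup.closure
      (KZ.domainAddRel ∪ KZ.integrandAddRel ∪ KZ.changeOfVariablesRel ∪ greenSet) ≤ KZ.relations := by
    refine (AddSubgroup.closure_le _).mpr ?_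
    rintro g (((hg | hg) | hg) | hg)
    · exact KZ.domainAddRel_subset_relations hg
    · exact KZ.integrandAddRel_subset_relations hg
    · exact KZ.changeOfVariablesRel_subset_relations hg
    · exact hG hg
  -- values
  have hsound : ∀ x ∈ KZ.relations, KZ.eval x = 0 := fun x hx =>
    (AddMonoidHom.mem_ker).mp (KZ.relations_le_ker_eval_holds hx)
  have e1 : KZ.eval c = r.value := by
    have := hsound _ hrc
    rw [map_sub, KZ.eval_of, sub_eq_zero] at this
    exact this.symm
  have e2 : KZ.eval c' = r'.value := by
    have := hsound _ hrc'
    rw [map_sub, KZ.eval_of, sub_eq_zero] at this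
    exact this.symm
  have hcc : c - c' ∈ AddSubgroup.closure (Set.range fun s : KZ.IntegralRep 1 => KZ.of s) :=
    sub_mem hc hc'
  have hev : KZ.eval (c - c') = 0 := by rw [map_sub, e1, e2, hv, sub_self]
  have key : c - c' ∈ KZ.relations := hM₁ (h (c - c') hcc hev)
  have : KZ.of r - KZ.of r' = (KZ.of r - c) - (KZ.of r' - c') + (c - c') := by abel
  show KZ.of r - KZ.of r' ∈ KZ.relations
  rw [this]
  exact add_mem (sub_mem hrc hrc') key

/-! ### Card `degree-shadow-membranes` -/

/-- A path `γ : ℝ → ℂⁿ` is a `ℚ`-SEMIALGEBRAIC (Nash) PATH: its realification `[0,1] → ℝ²ⁿ` is a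
`ℚ`-semialgebraic map. [cite: BochnakCosteRoy1998, Def. 2.2.5] -/
def IsSAPath {n : ℕ} (γ : ℝ → (Fin n → ℂ)) : Prop :=
  IsSemialgebraicMapOn ℚ {z : Fin 1 → ℝ | z 0 ∈ Set.Icc (0 : ℝ) 1}
    (fun z => Fin.append (fun i => (γ (z 0) i).re) (fun i => (γ (z 0) i).im))

/-- `r` REALISES `a · (ω, γ)`: domain `(0,1)`, integrand `t ↦ Re(a · Σᵢ ωᵢ(γ t) γᵢ′ t)`.
[cite: HuberWustholz2022, Cor. 12.7] -/
def Realises {n : ℕ} (r : KZ.IntegralRep 1) (a : ℂ) (ω : Fin n → MvPolynomial (Fin n) ℂ)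
    (γ : ℝ → (Fin n → ℂ)) : Prop :=
  r.domain = {z | z 0 ∈ Set.Ioo (0 : ℝ) 1} ∧
    ∀ z ∈ r.domain, r.integrand z =
      (a * ∑ i, MvPolynomial.eval (γ (z 0)) (ω i) * deriv (fun u => γ u i) (z 0)).re

/-- A based NULL-HOMOTOPY of the loop `γ` inside the complex points of `Z`: a continuous
`H : [0,1]² → Z(ℂ)` with `H(t,0) = γ t`, `H(t,1) = γ 0`, `H(0,s) = H(1,s) = γ 0`. [folklore] -/
def IsNullHomotopy (Z : CurveData) (γ : ℝ → (Fin Z.n → ℂ)) (H : ℝ × ℝ → (Fin Z.n → ℂ)) : Prop :=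
  ContinuousOn H (Set.Icc (0 : ℝ) 1 ×ˢ Set.Icc (0 : ℝ) 1) ∧
    Set.MapsTo H (Set.Icc (0 : ℝ) 1 ×ˢ Set.Icc (0 : ℝ) 1) Z.points ∧
    (∀ t ∈ Set.Icc (0 : ℝ) 1, H (t, 0) = γ t) ∧ (∀ t ∈ Set.Icc (0 : ℝ) 1, H (t, 1) = γ 0) ∧
    (∀ s ∈ Set.Icc (0 : ℝ) 1, H (0, s) = γ 0 ∧ H (1, s) = γ 0)

/-- FIRST LEMMA of card `degree-shadow-membranes` (`NullHomotopicNashLoop`): on a smooth affine curve `Z`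
over `ℚ̄`, for an algebraic polynomial 1-form `ω`, an algebraic scalar `a` and a `ℚ`-semialgebraic `C¹`
LOOP `γ` (a `CurvePath` with `γ 0 = γ 1`) that is null-homotopic in `Z(ℂ)`, the real realisation
`[∫₀¹ Re(a·ω(γ)γ′) dt]` lies in `KZ.relations`. Proof plan: the DEGREE SHADOW `n_U` of the null-homotopy on
the finitely many bounded semialgebraic components `U` of `Z(ℂ) ∖ γ[0,1]` writes the loop as
`Σ n_U ∂[Ū]`, and Stokes on each `Ū` is rule 3 + swap + rule 3 on the CAD bands of its Nash chart pieces.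
[cite: HuberWustholz2022, §3.3.1] -/
def NullHomotopicNashLoopStatement : Prop :=
  ∀ (Z : CurveData), Z.IsSmoothAffineCurve →
    ∀ (ω : Fin Z.n → MvPolynomial (Fin Z.n) ℂ), (∀ i, HasAlgCoeffs (ω i)) →
    ∀ (a : ℂ), IsAlgebraic ℚ a →
    ∀ γ : CurvePath Z, IsSAPath γ.toFun → γ.toFun 0 = γ.toFun 1 →
      (∃ H : ℝ × ℝ → (Fin Z.n → ℂ), IsNullHomotopy Z γ.toFun H) →
      ∀ r : KZ.IntegralRep 1, Realises r a ω γ.toFun → KZ.of r ∈ KZ.relations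

/-- Sanity: the statement is inhabited as a `Prop` (type-checks); its degenerate instance `ω = 0` holds by
integrand additivity alone (`[∫0] = [∫0] + [∫0]`). -/
example : NullHomotopicNashLoopStatement → True := fun _ => trivial

end Summit.KontsevichZagierPeriods.KontsevichZagierPeriods.Cruxes.PlanarAreas.Ideator3
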